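import Mathlib.GroupTheory.SpecificGroups.Dihedral
import Mathlib.Data.ZMod.Basic
import Mathlib.Tactic
import Literature.Combinatorics.Additive.TripleProductProperty
import Literature.Computability.AlgebraicComplexity.CohnUmansTPP
import HarnessLib

/-!
# A counterexample of order 70 to the Hedtke–Murthy index-2 conjecture

Contributed by the speedrun lane `tpp`, seat `sr-tpp-search-g10` (2026-08-20); source
`run/shared/lean/speedrun/tpp/sr-tpp-search-g10/conj/C7xD10_tpp_6_4_4.lean` (sha256
`6da26a782da0f73aa1222149dcf8d78c42f1299a8a64af9036000b545f973ec6`), restated over the tree definition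
`TripleProductProperty` for the cell `pub-omega` (topic
`Summits/MatrixMultiplication/OmegaCensus`, ruling L5-9).  HONEST FRAMING: one explicit triple checked by `decide`;
a census lower bound, nothing on `ω`.
Dihedral convention = Mathlib's (`r i * sr j = sr (j-i)`, `sr i * sr j = r (j-i)`); independently re-verified from
scratch by the cell's referee (INBOX 2026-08-20T17:49:30Z) for the order-50 and C₇×D₁₀ triples.

Hedtke–Murthy (Groups Complex. Cryptol. 4 (2012), Conjecture 7.6; restated as Conjecture 1.3 of S. Murthy,
arXiv:2512.16730 (2025))
conjectured: if a finite group `G` has a cyclic subgroup of index 2 then its TPP capacity satisfies `β(G) ≤ 4|G|/3`,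
i.e. every triple of
subsets `S, T, U ⊆ G` with the triple product property has `|S||T||U| ≤ 4|G|/3`.

The group `G = C7 × D10` (here `Multiplicative (ZMod 7) × DihedralGroup 5`, order 70) has the cyclic subgroup
generated by
`(1, r 1)` of order 35 = |G|/2, and the three subsets below (sizes 6, 4, 4, volume 96 > 4·70/3 = 93.33) satisfy the
TPP
(the tree's `RealizesTPP`,
    Cohn–Umans right-quotient form).  Hence the conjecture is false; 70 is the smallest order of a counterexample in the
lane's exact census of all groups of order ≤ 127 (speedrun tpp, seat sr-tpp-search-g10; the witness is the census
β-witness of `AG-70-2`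
transported along an explicit isomorphism, found by kit-compute exhaustive search and re-verified in Python before
this Lean check).
Dihedral and dicyclic groups themselves satisfy `β ≤ 4|G|/3` throughout the census (exact for |G| ≤ 126).

Tree restyling by the cell `pub-omega` (seat pub-omega-group-g3, 2026-08-20, ruling L5-9 (2)): the lane's tree-ready
file
`CyclicSevenDihedralTenTPP96.lean` (sha256 `45c222a33767f74883249f50b65f711876f0f9c8cc54f7c1d81a3f34cf81fc3f`) is
landed here in the OmegaCensus house style — no auxiliary definitions (the
carrier type and the three sets are written out literally in each statement), a docstring on every declaration,
kernel `decide`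
(`decide +kernel`) instead of raised heartbeats; the mathematical content and the sets are unchanged.
Framing: lottery ticket; floor = certified bounds/negative ranges.
-/

namespace Summit.MatrixMultiplication.OmegaCensus.CyclicSevenDihedralTenTPP96

open Literature.Computability.AlgebraicComplexity Literature.Combinatorics.Additive

/-- `|Multiplicative (ZMod 7) × DihedralGroup 5| = 70`. [folklore] -/
theorem card_G : Fintype.card (Multiplicative (ZMod 7) × DihedralGroup 5) = 70 := by
  simp [Fintype.card_prod, ZMod.card, DihedralGroup.card]

/-- `(Multiplicative.ofAdd (1 : ZMod 7), DihedralGroup.r (1 : ZMod 5))` has order `35 = |G|/2`: a cyclic subgroup of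
index 2. [folklore] -/
theorem orderOf_gen : orderOf (((Multiplicative.ofAdd (1 : ZMod 7), DihedralGroup.r (1 : ZMod 5)) :
    Multiplicative (ZMod 7) × DihedralGroup 5)) = 35 := by
  rw [Prod.orderOf_mk, orderOf_ofAdd_eq_addOrderOf, ZMod.addOrderOf_one, DihedralGroup.orderOf_r_one]; norm_num

/-- `2 · 35 = |G|`. [folklore] -/
theorem two_mul_orderOf_gen :
    2 * orderOf (((Multiplicative.ofAdd (1 : ZMod 7), DihedralGroup.r (1 : ZMod 5)) : Multiplicative (ZMod 7) ×
        DihedralGroup 5)) = Fintype.card (Multiplicative (ZMod 7) × DihedralGroup 5) := by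
  rw [orderOf_gen, card_G]

/-- **A `(6,4,4)` TPP triple of `Multiplicative (ZMod 7) × DihedralGroup 5`** (volume `96`; kernel `decide`; lane
tpp census witness). [folklore] -/
theorem tpp : TripleProductProperty
      ({(Multiplicative.ofAdd (0 : ZMod 7), DihedralGroup.r (0 : ZMod 5)),
    (Multiplicative.ofAdd (1 : ZMod 7), DihedralGroup.r (4 : ZMod 5)),
    (Multiplicative.ofAdd (3 : ZMod 7), DihedralGroup.r (4 : ZMod 5)),
    (Multiplicative.ofAdd (4 : ZMod 7), DihedralGroup.r (3 : ZMod 5)),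
    (Multiplicative.ofAdd (5 : ZMod 7), DihedralGroup.r (2 : ZMod 5)),
    (Multiplicative.ofAdd (6 : ZMod 7), DihedralGroup.r (1 : ZMod 5))} :
        Finset (Multiplicative (ZMod 7) × DihedralGroup 5))
      ({(Multiplicative.ofAdd (0 : ZMod 7), DihedralGroup.r (0 : ZMod 5)),
    (Multiplicative.ofAdd (0 : ZMod 7), DihedralGroup.sr (0 : ZMod 5)),
    (Multiplicative.ofAdd (1 : ZMod 7), DihedralGroup.r (1 : ZMod 5)),
    (Multiplicative.ofAdd (1 : ZMod 7), DihedralGroup.sr (4 : ZMod 5))} :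
        Finset (Multiplicative (ZMod 7) × DihedralGroup 5))
      ({(Multiplicative.ofAdd (0 : ZMod 7), DihedralGroup.r (0 : ZMod 5)),
    (Multiplicative.ofAdd (0 : ZMod 7), DihedralGroup.sr (1 : ZMod 5)),
    (Multiplicative.ofAdd (2 : ZMod 7), DihedralGroup.r (2 : ZMod 5)),
    (Multiplicative.ofAdd (2 : ZMod 7), DihedralGroup.sr (4 : ZMod 5))} :
        Finset (Multiplicative (ZMod 7) × DihedralGroup 5)) := by
  unfold TripleProductProperty; decide +kernel

/-- `Multiplicative (ZMod 7) × DihedralGroup 5` realizes `⟨6,4,4⟩` (Cohn–Umans right-quotient TPP, the tree's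
`RealizesTPP`). [folklore] -/
theorem realizesTPP_6_4_4 : RealizesTPP (Multiplicative (ZMod 7) × DihedralGroup 5) 6 4 4 :=
  ⟨_, _, _, by decide +kernel, by decide +kernel, by decide +kernel, tpp⟩

/-- The volume exceeds `4|G|/3`: `4 · 70 < 3 · 96`. [folklore] -/
theorem volume_gt : 4 * Fintype.card (Multiplicative (ZMod 7) × DihedralGroup 5) < 3 * (6 * 4 * 4) := by
  rw [card_G]; norm_num

/-- **The Hedtke–Murthy index-2 conjecture** (HM12 Conj. 7.6 / Murthy 2025 Conj. 1.3: a finite group with an element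
of order `|G|/2` has every TPP triple of volume `≤ 4|G|/3`) **is false**, witnessed by this group of order 70.
[folklore] -/
theorem hedtkeMurthy_index2_conjecture_false :
    ¬ (∀ (H : Type) [Group H] [Fintype H] [DecidableEq H],
        (∃ g : H, 2 * orderOf g = Fintype.card H) →
        ∀ a b c : ℕ, RealizesTPP H a b c → 3 * (a * b * c) ≤ 4 * Fintype.card H) := by
  intro h
  have h1 := h (Multiplicative (ZMod 7) × DihedralGroup 5) ⟨_, two_mul_orderOf_gen⟩ 6 4 4 realizesTPP_6_4_4
  have h2 := volume_gt
  omega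

end Summit.MatrixMultiplication.OmegaCensus.CyclicSevenDihedralTenTPP96
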